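import Literature.NumberTheory.EllipticCurves.GaussianLatticeQuarterValues
import HarnessLib

/-!
# The Gaussian lattice `ℤi + ℤ`: complex multiplication by `1 + i`, the quarter point
# `(1+2i)/4`, and the real `5`-division values of `℘`

Topic `Literature/NumberTheory/EllipticCurves`, continuing `GaussianLatticeQuarterValues`
(`Λ = ℤi + ℤ`, `ϖ₀ = Γ(1/4)²/(2√(2π))`, `e₁ = ℘(1/2) = ϖ₀²`, `g₂ = 4ϖ₀⁴`, `g₃ = 0`,
`℘(1/4) = (1+√2)ϖ₀²`, `℘((3+2i)/4) = (1−√2)ϖ₀²`, `ζ((3+2i)/4)`). Everything here is proved; there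
are no new definitions. These are the lattice constants entering Birch and Swinnerton-Dyer's
finite formula for `L(E_D, 1)` in **Case 2** of *Notes on elliptic curves. II* (Crelle 218
(1965), p. 87, (3.15)) with `Δ = 5` — the case `D = −25`, i.e. the congruent number curve
`E₁₀ : y² = x³ − 100x` (`L₁₀₀ = L₋₂₅`, loc. cit. p. 86) of Tunnell's theorem:

* `derivWeierstrassP_one_add_two_I_quarter` — **`℘'((1+2i)/4) = 2(2 − √2)ϖ₀³`** (and
  `℘((1+2i)/4) = (1 − √2)ϖ₀²`, `ζ((1+2i)/4) = π/4 − πi/2 − (1−√2)ϖ₀/2`): BSD's second class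
  `γ = 3 + 2i ≡ −(1+2i)` modulo `(4)`, whose `℘(γω/4) = 1 − √2` is the other root of their
  `℘² − 2℘ − 1`; the sign of `℘'` comes from the duplication formula for `ζ`
  (`ζ(2v) = 2ζ(v) + ½℘''(v)/℘'(v)` at `v = (1+2i)/4`, `2v ≡ ½ + i`), not from a monotonicity
  argument;
* `weierstrassP_one_add_I_mul` — **complex multiplication by `1 + i`**:
  `℘((1+i)u) = −i(℘(u)² − ϖ₀⁴)/(2℘(u))` (the addition theorem at `(u, iu)` with `℘(iu) = −℘(u)`,
  `℘'(iu) = i℘'(u)`); BSD's (3.12) is the corresponding formula for `ζ`;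
* **the real `5`-division values** `p₁ = ℘(1/5) > p₂ = ℘(2/5) > e₁`: the duplication formula gives
  `p₂ · 4p₁(p₁² − e₁²) = (p₁² + e₁²)²` and, as `℘(4/5) = ℘(1/5)`, the same with `p₁, p₂`
  exchanged (`weierstrassPRe_two_fifths_mul`, `weierstrassPRe_one_fifth_mul`); eliminating,
  `p₁/ϖ₀²` and `p₂/ϖ₀²` are roots of the even octic factor
  `x⁸ − 12x⁶ − 26x⁴ + 52x² + 1` of the `5`-division polynomial of `y² = x³ − x`
  (`octic_weierstrassPRe_one_fifth`, `…_two_fifths`), and since this octic in `t = x²` is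
  `((t−3)² − 4√5(t−1))((t−3)² + 4√5(t−1))` with the second factor positive for `t > 1`,
  **`t₁ + t₂ = (6 + 4√5)ϖ₀⁴`, `t₁t₂ = (9 + 4√5)ϖ₀⁸` for `tᵢ = pᵢ²`** (`fifth_division_vieta`) —
  the symmetric functions through which the `Δ = 5` sum of (3.15) is evaluated without
  solving for the division values themselves.

## References

* B. J. Birch, H. P. F. Swinnerton-Dyer, *Notes on elliptic curves. II*, J. reine angew. Math.
  218 (1965) 79–108, §3 (3.8), (3.12), (3.15), p. 85–87 (GDZ `PPN243919689_0218`).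
* E. T. Whittaker, G. N. Watson, *A Course of Modern Analysis*, §20.33, §20.311 (duplication),
  §22.8 (lemniscate functions).
-/

noncomputable section

open Complex PeriodPair Real Set Filter
open scoped Real Topology PeriodPair

namespace Literature.NumberTheory.EllipticCurves

namespace GaussianLattice

/-! ### Casts of the constant `ϖ₀ = Γ(1/4)²/(2√(2π))` -/

/-- `(√2)² = 2` in `ℂ` (private copy of a frequently re-proved triviality). [folklore] -/
private theorem sqrt_two_sq_complex : ((Real.sqrt 2 : ℝ) : ℂ) ^ 2 = 2 := by
  rw [← Complex.ofReal_pow, Real.sq_sqrt (by norm_num)]; push_cast; ring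

/-- `ϖ₀ ≠ 0` in `ℂ`. [folklore] -/
theorem varpi_complex_ne_zero :
    ((Real.Gamma (1 / 4) ^ 2 / (2 * Real.sqrt (2 * π)) : ℝ) : ℂ) ≠ 0 :=
  Complex.ofReal_ne_zero.mpr varpi_pos.ne'

/-! ### The quarter point `(1+2i)/4 ≡ −(3+2i)/4 (mod Λ)` -/

/-- `(1+2i)/4 ∉ ℤi + ℤ`. [folklore] -/
theorem one_add_two_I_quarter_notMem :
    ((1 + 2 * I) / 4 : ℂ) ∉ (ofUpperHalfPlane UpperHalfPlane.I).lattice := by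
  refine notMem_lattice_of_re fun n h ↦ ?_
  norm_num at h
  have h4 : (4 * n : ℝ) = 1 := by linarith
  have : (4 * n : ℤ) = 1 := by exact_mod_cast h4
  omega

/-- **`℘((1+2i)/4) = (1 − √2)ϖ₀²`** (`= ℘(−(3+2i)/4 + (1+i))`). [folklore] -/
theorem weierstrassP_one_add_two_I_quarter :
    ℘[ofUpperHalfPlane UpperHalfPlane.I] ((1 + 2 * I) / 4) =
      (1 - (Real.sqrt 2 : ℂ)) *
        ((Real.Gamma (1 / 4) ^ 2 / (2 * Real.sqrt (2 * π)) : ℝ) : ℂ) ^ 2 := by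
  have h := (ofUpperHalfPlane UpperHalfPlane.I).weierstrassP_add_coe (-((3 + 2 * I) / 4))
    ⟨1 + I, one_add_I_mem⟩
  rw [Subtype.coe_mk, show -((3 + 2 * I) / 4) + (1 + I) = (1 + 2 * I) / 4 by ring,
    weierstrassP_neg, weierstrassP_three_add_two_I_quarter] at h
  exact h

/-- **`ζ((1+2i)/4) = π/4 − πi/2 − (1 − √2)ϖ₀/2`** (`ζ(−(3+2i)/4 + (1+i)) = −ζ((3+2i)/4) + π − πi`).
[folklore] -/
theorem weierstrassZeta_one_add_two_I_quarter :
    (ofUpperHalfPlane UpperHalfPlane.I).weierstrassZeta ((1 + 2 * I) / 4) =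
      π / 4 - π * I / 2 -
        (1 - (Real.sqrt 2 : ℂ)) *
          ((Real.Gamma (1 / 4) ^ 2 / (2 * Real.sqrt (2 * π)) : ℝ) : ℂ) / 2 := by
  have h := (ofUpperHalfPlane UpperHalfPlane.I).weierstrassZeta_add_period 1 1 (-((3 + 2 * I) / 4))
  rw [ofUpperHalfPlane_ω₁, ofUpperHalfPlane_ω₂, UpperHalfPlane.coe_I, η₁_eq, η₂_eq, Int.cast_one,
    one_mul, one_mul, one_mul, one_mul,
    show -((3 + 2 * I) / 4) + (I + 1) = (1 + 2 * I) / 4 by ring, weierstrassZeta_neg,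
    weierstrassZeta_three_add_two_I_quarter] at h
  rw [h]
  ring

/-- **`℘'((1+2i)/4) = 2(2 − √2)ϖ₀³`** for `ℤi + ℤ`. With `v = (1+2i)/4`, `2v = ½ + i`: the
duplication formula `ζ(2v) = 2ζ(v) + ½℘''(v)/℘'(v)` (`PeriodPair.weierstrassZeta_two_mul`) with
`ζ(½ + i) = π/2 − πi`, `ζ(v) = π/4 − πi/2 − (1−√2)ϖ₀/2` and `℘''(v) = 6℘(v)² − g₂/2 =
(16 − 12√2)ϖ₀⁴` gives `℘'(v) = ℘''(v)/(2(1−√2)ϖ₀) = (4 − 2√2)ϖ₀³`. [folklore] -/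
theorem derivWeierstrassP_one_add_two_I_quarter :
    ℘'[ofUpperHalfPlane UpperHalfPlane.I] ((1 + 2 * I) / 4) =
      2 * (2 - (Real.sqrt 2 : ℂ)) *
        ((Real.Gamma (1 / 4) ^ 2 / (2 * Real.sqrt (2 * π)) : ℝ) : ℂ) ^ 3 := by
  set s : ℂ := (Real.sqrt 2 : ℂ) with hs_def
  set w : ℂ := ((Real.Gamma (1 / 4) ^ 2 / (2 * Real.sqrt (2 * π)) : ℝ) : ℂ) with hw_def
  have hs2 : s ^ 2 = 2 := sqrt_two_sq_complex
  have hw : w ≠ 0 := varpi_complex_ne_zero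
  have h1s : (1 : ℂ) - s ≠ 0 := by
    intro h
    have : s = 1 := by linear_combination -h
    rw [this] at hs2
    norm_num at hs2
  set v : ℂ := (1 + 2 * I) / 4 with hv
  have hvn : v ∉ (ofUpperHalfPlane UpperHalfPlane.I).lattice := one_add_two_I_quarter_notMem
  have hPv : ℘[ofUpperHalfPlane UpperHalfPlane.I] v = (1 - s) * w ^ 2 :=
    weierstrassP_one_add_two_I_quarter
  -- `℘'(v)² = 8(1 − √2)²ϖ₀⁶ ≠ 0`
  have hsq := (ofUpperHalfPlane UpperHalfPlane.I).derivWeierstrassP_sq v hvn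
  rw [hPv, g₂_eq_varpi', g₃_ofUpperHalfPlane_I, sub_zero] at hsq
  have hsq' : ℘'[ofUpperHalfPlane UpperHalfPlane.I] v ^ 2 = 8 * (1 - s) ^ 2 * w ^ 6 := by
    rw [hsq]; linear_combination (4 * (1 - s) * w ^ 6) * hs2
  have hD : ℘'[ofUpperHalfPlane UpperHalfPlane.I] v ≠ 0 := by
    intro h0
    rw [h0] at hsq'
    have : (8 : ℂ) * (1 - s) ^ 2 * w ^ 6 ≠ 0 :=
      mul_ne_zero (mul_ne_zero (by norm_num) (pow_ne_zero _ h1s)) (pow_ne_zero _ hw)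
    exact this (by simpa using hsq'.symm)
  -- the duplication formula for `ζ`
  have hdup := (ofUpperHalfPlane UpperHalfPlane.I).weierstrassZeta_two_mul hvn hD
  have h2v : 2 * v = 1 / 2 + I := by simp only [hv]; ring
  rw [h2v, weierstrassZeta_add_I, weierstrassZeta_half, weierstrassZeta_one_add_two_I_quarter,
    (ofUpperHalfPlane UpperHalfPlane.I).deriv_derivWeierstrassP hvn, hPv, g₂_eq_varpi',
    ← hw_def, ← hs_def] at hdup
  -- solve for `℘'(v)`
  set D : ℂ := 6 * ((1 - s) * w ^ 2) ^ 2 - 4 * w ^ 4 / 2 with hD_def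
  have h1 : D / ℘'[ofUpperHalfPlane UpperHalfPlane.I] v / 2 = (1 - s) * w := by
    linear_combination -hdup
  have h1sw : 2 * (1 - s) * w ≠ 0 := mul_ne_zero (mul_ne_zero two_ne_zero h1s) hw
  have key : ℘'[ofUpperHalfPlane UpperHalfPlane.I] v * (2 * (1 - s) * w) = D := by
    rw [mul_assoc 2 (1 - s) w, ← h1]
    field_simp
  rw [← eq_div_iff h1sw] at key
  rw [key, div_eq_iff h1sw, hD_def]
  linear_combination (2 * w ^ 4) * hs2

/-! ### Complex multiplication by `1 + i` -/

/-- **Complex multiplication by `1 + i` on `y² = 4x³ − 4ϖ₀⁴x`**: for `u ∉ Λ` with `℘(u) ≠ 0`,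
`℘((1+i)u) = −i(℘(u)² − ϖ₀⁴)/(2℘(u))` — the addition theorem
`℘(u+v) = ¼((℘'(u) − ℘'(v))/(℘(u) − ℘(v)))² − ℘(u) − ℘(v)` at `v = iu` (`℘(iu) = −℘(u)`,
`℘'(iu) = i℘'(u)`, `℘'² = 4℘³ − 4ϖ₀⁴℘`). In coordinates `x = ℘/ϖ₀²` on `y² = x³ − x` this is
`x((1+i)P) = (x² − 1)/(2ix)`. [cite: BirchSwinnertonDyer1965NotesII, §3 (3.12)] -/
theorem weierstrassP_one_add_I_mul {u : ℂ} (hu : u ∉ (ofUpperHalfPlane UpperHalfPlane.I).lattice)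
    (h0 : ℘[ofUpperHalfPlane UpperHalfPlane.I] u ≠ 0) :
    ℘[ofUpperHalfPlane UpperHalfPlane.I] ((1 + I) * u) =
      -I * (℘[ofUpperHalfPlane UpperHalfPlane.I] u ^ 2 -
        ((Real.Gamma (1 / 4) ^ 2 / (2 * Real.sqrt (2 * π)) : ℝ) : ℂ) ^ 4) /
        (2 * ℘[ofUpperHalfPlane UpperHalfPlane.I] u) := by
  set w : ℂ := ((Real.Gamma (1 / 4) ^ 2 / (2 * Real.sqrt (2 * π)) : ℝ) : ℂ) with hw_def
  set p := ℘[ofUpperHalfPlane UpperHalfPlane.I] u with hp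
  set q := ℘'[ofUpperHalfPlane UpperHalfPlane.I] u with hq
  have hIu : I * u ∉ (ofUpperHalfPlane UpperHalfPlane.I).lattice := by
    rw [I_mul_mem_lattice_ofUpperHalfPlane_I_iff]; exact hu
  have hPI : ℘[ofUpperHalfPlane UpperHalfPlane.I] (I * u) = -p := weierstrassP_I_mul u
  have hDI : ℘'[ofUpperHalfPlane UpperHalfPlane.I] (I * u) = I * q := derivWeierstrassP_I_mul u
  have hne : ℘[ofUpperHalfPlane UpperHalfPlane.I] u ≠
      ℘[ofUpperHalfPlane UpperHalfPlane.I] (I * u) := by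
    rw [hPI]
    intro h
    apply h0
    linear_combination h / 2
  have hadd := weierstrassP_add_holds (L := ofUpperHalfPlane UpperHalfPlane.I) u (I * u) hu hIu hne
  have hsq := (ofUpperHalfPlane UpperHalfPlane.I).derivWeierstrassP_sq u hu
  rw [g₂_eq_varpi', g₃_ofUpperHalfPlane_I, sub_zero] at hsq
  rw [show (1 + I) * u = u + I * u by ring, hadd, hPI, hDI, ← hp, ← hq]
  rw [← hp, ← hq] at hsq
  have h2p : (2 : ℂ) * p ≠ 0 := mul_ne_zero two_ne_zero h0
  have hpp : p - -p ≠ 0 := by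
    intro h; apply h0; linear_combination h / 2
  have h16 : (16 : ℂ) * p ^ 2 ≠ 0 := mul_ne_zero (by norm_num) (pow_ne_zero _ h0)
  have hI2 : I ^ 2 = -1 := I_sq
  have e1 : ((q - I * q) / (p - -p)) ^ 2 / 4 - p - -p = (1 - I) ^ 2 * q ^ 2 / (16 * p ^ 2) := by
    field_simp
    ring
  rw [e1, div_eq_div_iff h16 h2p, hsq]
  linear_combination (8 * p ^ 2 * (p ^ 2 - w ^ 4)) * hI2

/-! ### The real `5`-division values `℘(1/5)`, `℘(2/5)` -/

/-- `k/5 ∉ ℤi + ℤ` for `k = 1, 2, 4`, real-cast form. [folklore] -/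
theorem ofReal_fifth_notMem {k : ℕ} (hk1 : 1 ≤ k) (hk : k ≤ 4) :
    (((k : ℝ) / 5 : ℝ) : ℂ) ∉ (ofUpperHalfPlane UpperHalfPlane.I).lattice := by
  refine isReal.ofReal_notMem_lattice (by positivity) ?_
  rw [minRealPeriod_eq]
  have : (k : ℝ) ≤ 4 := by exact_mod_cast hk
  linarith

/-- The ordering of the real division values: **`ϖ₀² = ℘(1/2) < ℘(2/5) < ℘(1/4) < ℘(1/5)`**
(`℘` decreases on `(0, 1/2]`). [folklore] -/
theorem weierstrassPRe_fifths_order :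
    (Real.Gamma (1 / 4) ^ 2 / (2 * Real.sqrt (2 * π))) ^ 2 <
        (ofUpperHalfPlane UpperHalfPlane.I).weierstrassPRe (2 / 5) ∧
      (ofUpperHalfPlane UpperHalfPlane.I).weierstrassPRe (2 / 5) <
        (ofUpperHalfPlane UpperHalfPlane.I).weierstrassPRe (1 / 4) ∧
      (ofUpperHalfPlane UpperHalfPlane.I).weierstrassPRe (1 / 4) <
        (ofUpperHalfPlane UpperHalfPlane.I).weierstrassPRe (1 / 5) := by
  have h := isReal.strictAntiOn_weierstrassPRe (L := ofUpperHalfPlane UpperHalfPlane.I)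
  rw [minRealPeriod_eq] at h
  refine ⟨?_, ?_, ?_⟩
  · rw [← weierstrassPRe_half_eq_varpi_sq]
    exact h ⟨by norm_num, by norm_num⟩ ⟨by norm_num, by norm_num⟩ (by norm_num)
  · exact h ⟨by norm_num, by norm_num⟩ ⟨by norm_num, by norm_num⟩ (by norm_num)
  · exact h ⟨by norm_num, by norm_num⟩ ⟨by norm_num, by norm_num⟩ (by norm_num)

/-- **Duplication on the real axis** (real form, `e₁ = ϖ₀²`): for `0 < a`, `2a < 1` with
`℘(a) ≠ 0`, `℘(2a) · 4℘(a)(℘(a)² − e₁²) = (℘(a)² + e₁²)²`, i.e. `x(2P) = (x² + 1)²/(4x(x² − 1))` on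
`y² = x³ − x` — the tree's `℘(2u) = ¼(℘''(u)/℘'(u))² − 2℘(u)`
(`PeriodPair.weierstrassP_two_mul_holds`)
with `℘'' = 6℘² − g₂/2`, `℘'² = 4℘³ − g₂℘`, `g₂ = 4e₁²`; `℘'(a) ≠ 0` because `2a ∉ Λ`. [folklore] -/
theorem weierstrassPRe_two_mul_fifth_aux {a : ℝ} (ha0 : 0 < a) (ha1 : 2 * a < 1)
    (hval : (ofUpperHalfPlane UpperHalfPlane.I).weierstrassPRe a ≠ 0) :
    (ofUpperHalfPlane UpperHalfPlane.I).weierstrassPRe (2 * a) *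
        (4 * (ofUpperHalfPlane UpperHalfPlane.I).weierstrassPRe a *
          ((ofUpperHalfPlane UpperHalfPlane.I).weierstrassPRe a ^ 2 -
            ((Real.Gamma (1 / 4) ^ 2 / (2 * Real.sqrt (2 * π))) ^ 2) ^ 2)) =
      ((ofUpperHalfPlane UpperHalfPlane.I).weierstrassPRe a ^ 2 +
        ((Real.Gamma (1 / 4) ^ 2 / (2 * Real.sqrt (2 * π))) ^ 2) ^ 2) ^ 2 := by
  set L := ofUpperHalfPlane UpperHalfPlane.I with hL
  set e : ℝ := (Real.Gamma (1 / 4) ^ 2 / (2 * Real.sqrt (2 * π))) ^ 2 with he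
  have han : ((a : ℝ) : ℂ) ∉ L.lattice :=
    isReal.ofReal_notMem_lattice ha0 (by rw [minRealPeriod_eq]; linarith)
  have h2an : (((2 * a : ℝ)) : ℂ) ∉ L.lattice :=
    isReal.ofReal_notMem_lattice (by linarith) (by rw [minRealPeriod_eq]; linarith)
  -- `℘'(a) ≠ 0` since `2a ∉ Λ`
  have hD : ℘'[L] (a : ℂ) ≠ 0 := by
    intro h0
    have h2 := L.two_mul_mem_lattice_of_derivWeierstrassP_eq_zero han h0
    apply h2an
    push_cast
    exact h2
  have hdup := weierstrassP_two_mul_holds (L := L) (a : ℂ) han hD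
  have hsq := L.derivWeierstrassP_sq (a : ℂ) han
  rw [L.deriv_derivWeierstrassP han] at hdup
  rw [g₂_eq_varpi', g₃_ofUpperHalfPlane_I, sub_zero] at hsq
  rw [g₂_eq_varpi'] at hdup
  -- pass to the real values
  have hPa : ℘[L] (a : ℂ) = (L.weierstrassPRe a : ℂ) := (isReal.ofReal_weierstrassPRe a).symm
  have hP2a : ℘[L] (2 * (a : ℂ)) = (L.weierstrassPRe (2 * a) : ℂ) := by
    rw [show (2 * (a : ℂ)) = ((2 * a : ℝ) : ℂ) by push_cast; ring]
    exact (isReal.ofReal_weierstrassPRe _).symm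
  have hDa : ℘'[L] (a : ℂ) = (L.derivWeierstrassPRe a : ℂ) :=
    (isReal.ofReal_derivWeierstrassPRe a).symm
  set p : ℝ := L.weierstrassPRe a with hp
  set p2 : ℝ := L.weierstrassPRe (2 * a) with hp2
  set q : ℝ := L.derivWeierstrassPRe a with hq
  rw [hPa, hP2a, hDa] at hdup
  rw [hPa, hDa] at hsq
  have hw : ((((Real.Gamma (1 / 4) ^ 2 / (2 * Real.sqrt (2 * π))) : ℝ)) : ℂ) ^ 4 = (e : ℂ) ^ 2 := by
    rw [he]; push_cast; ring
  rw [hw] at hdup hsq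
  have hq0 : (q : ℂ) ≠ 0 := by rwa [hDa] at hD
  have hq0' : q ≠ 0 := by exact_mod_cast hq0
  -- the complex identities, as real identities
  have hsqR : q ^ 2 = 4 * p ^ 3 - 4 * e ^ 2 * p := by exact_mod_cast hsq
  have h' : p2 = ((6 * p ^ 2 - 4 * e ^ 2 / 2) / q) ^ 2 / 4 - 2 * p := by exact_mod_cast hdup
  have hdupR : p2 * (4 * q ^ 2) = (6 * p ^ 2 - 4 * e ^ 2 / 2) ^ 2 - 2 * p * (4 * q ^ 2) := by
    rw [h']
    field_simp
  rw [hsqR] at hdupR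
  have hp0 : p ≠ 0 := hval
  -- `p2 · 16 p (p² − e²) = (6p² − 2e²)² − 32 p² (p² − e²) = 4 (p² + e²)²`
  have : p2 * (4 * p * (p ^ 2 - e ^ 2)) * 4 = (p ^ 2 + e ^ 2) ^ 2 * 4 := by
    linear_combination hdupR
  linarith

/-- **`℘(2/5) · 4℘(1/5)(℘(1/5)² − ϖ₀⁴) = (℘(1/5)² + ϖ₀⁴)²`** (duplication at `1/5`). [folklore] -/
theorem weierstrassPRe_two_fifths_mul :
    (ofUpperHalfPlane UpperHalfPlane.I).weierstrassPRe (2 / 5) *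
        (4 * (ofUpperHalfPlane UpperHalfPlane.I).weierstrassPRe (1 / 5) *
          ((ofUpperHalfPlane UpperHalfPlane.I).weierstrassPRe (1 / 5) ^ 2 -
            ((Real.Gamma (1 / 4) ^ 2 / (2 * Real.sqrt (2 * π))) ^ 2) ^ 2)) =
      ((ofUpperHalfPlane UpperHalfPlane.I).weierstrassPRe (1 / 5) ^ 2 +
        ((Real.Gamma (1 / 4) ^ 2 / (2 * Real.sqrt (2 * π))) ^ 2) ^ 2) ^ 2 := by
  have hord := weierstrassPRe_fifths_order
  have hpos : 0 < (ofUpperHalfPlane UpperHalfPlane.I).weierstrassPRe (1 / 5) := by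
    have h0 : 0 ≤ (Real.Gamma (1 / 4) ^ 2 / (2 * Real.sqrt (2 * π))) ^ 2 := sq_nonneg _
    linarith [hord.1, hord.2.1, hord.2.2]
  have h := weierstrassPRe_two_mul_fifth_aux (a := 1 / 5) (by norm_num) (by norm_num) hpos.ne'
  rw [show (2 * (1 / 5) : ℝ) = 2 / 5 by norm_num] at h
  exact h

/-- **`℘(1/5) · 4℘(2/5)(℘(2/5)² − ϖ₀⁴) = (℘(2/5)² + ϖ₀⁴)²`** (duplication at `2/5`, and
`℘(4/5) = ℘(−1/5 + 1) = ℘(1/5)`). [folklore] -/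
theorem weierstrassPRe_one_fifth_mul :
    (ofUpperHalfPlane UpperHalfPlane.I).weierstrassPRe (1 / 5) *
        (4 * (ofUpperHalfPlane UpperHalfPlane.I).weierstrassPRe (2 / 5) *
          ((ofUpperHalfPlane UpperHalfPlane.I).weierstrassPRe (2 / 5) ^ 2 -
            ((Real.Gamma (1 / 4) ^ 2 / (2 * Real.sqrt (2 * π))) ^ 2) ^ 2)) =
      ((ofUpperHalfPlane UpperHalfPlane.I).weierstrassPRe (2 / 5) ^ 2 +
        ((Real.Gamma (1 / 4) ^ 2 / (2 * Real.sqrt (2 * π))) ^ 2) ^ 2) ^ 2 := by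
  have hord := weierstrassPRe_fifths_order
  have hpos : 0 < (ofUpperHalfPlane UpperHalfPlane.I).weierstrassPRe (2 / 5) := by
    have h0 : 0 ≤ (Real.Gamma (1 / 4) ^ 2 / (2 * Real.sqrt (2 * π))) ^ 2 := sq_nonneg _
    linarith [hord.1]
  have h := weierstrassPRe_two_mul_fifth_aux (a := 2 / 5) (by norm_num) (by norm_num) hpos.ne'
  -- `℘(4/5) = ℘(1/5)`
  have h45 : (ofUpperHalfPlane UpperHalfPlane.I).weierstrassPRe (2 * (2 / 5)) =
      (ofUpperHalfPlane UpperHalfPlane.I).weierstrassPRe (1 / 5) := by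
    simp only [PeriodPair.weierstrassPRe]
    have hper := (ofUpperHalfPlane UpperHalfPlane.I).weierstrassP_add_coe
      (-(((1 / 5 : ℝ) : ℂ))) ⟨1, one_mem⟩
    rw [Subtype.coe_mk, weierstrassP_neg] at hper
    rw [← hper]
    congr 1
    push_cast
    ring
  rw [h45] at h
  exact h

/-- Positivity of the `(2 ± i)`-division factor: `5p⁴ − 2e²p² + e⁴ > 0`. [folklore] -/
theorem five_quartic_pos (p : ℝ) {e : ℝ} (he : 0 < e) :
    0 < 5 * p ^ 4 - 2 * e ^ 2 * p ^ 2 + e ^ 4 := by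
  nlinarith [sq_nonneg (5 * p ^ 2 - e ^ 2), sq_nonneg e, pow_pos he 4]

/-- **Elimination.** If `p₂ · 4p₁(p₁² − E) = (p₁² + E)²` and `p₁ · 4p₂(p₂² − E) = (p₂² + E)²` with
`p₁ ≠ p₂`, `p₁² ≠ E`, `p₁ ≠ 0`, `E = e² > 0`, then `p₁` is a root of the octic
`p⁸ − 12E p⁶ − 26E² p⁴ + 52E³ p² + E⁴` (the even octic factor of the `5`-division polynomial of
`y² = 4x³ − 4E x`): substituting the first relation into the second (times `(4p₁(p₁² − E))⁴`) gives
a degree-`16` relation which factors as `−(3p⁴ − 6Ep² − E²)(5p⁴ − 2Ep² + E²) × octic`; the first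
factor would force `p₂ = p₁` (it says `(p² + E)² = 4p²(p² − E)`), the second is positive.
[folklore] -/
theorem octic_of_two_mul_relations {p₁ p₂ e : ℝ} (he : 0 < e)
    (h₁ : p₂ * (4 * p₁ * (p₁ ^ 2 - e ^ 2)) = (p₁ ^ 2 + e ^ 2) ^ 2)
    (h₂ : p₁ * (4 * p₂ * (p₂ ^ 2 - e ^ 2)) = (p₂ ^ 2 + e ^ 2) ^ 2)
    (hne : p₁ ≠ p₂) (hp : p₁ ^ 2 ≠ e ^ 2) (hp0 : p₁ ≠ 0) :
    p₁ ^ 8 - 12 * e ^ 2 * p₁ ^ 6 - 26 * e ^ 4 * p₁ ^ 4 + 52 * e ^ 6 * p₁ ^ 2 + e ^ 8 = 0 := by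
  set V := (p₁ ^ 2 + e ^ 2) ^ 2 with hV
  set W := 4 * p₁ * (p₁ ^ 2 - e ^ 2) with hW
  have hW0 : W ≠ 0 := by
    simp only [hW]
    refine mul_ne_zero (mul_ne_zero four_ne_zero hp0) (sub_ne_zero.mpr hp)
  have hY : p₂ * W = V := h₁
  -- `h₂ × W⁴`, written in `p₂ W`
  have h2' : 4 * p₁ * (p₂ * W) * W * ((p₂ * W) ^ 2 - e ^ 2 * W ^ 2) =
      ((p₂ * W) ^ 2 + e ^ 2 * W ^ 2) ^ 2 := by
    linear_combination W ^ 4 * h₂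
  rw [hY] at h2'
  -- the degree-16 relation and its factorisation
  have hfac : -(3 * p₁ ^ 4 - 6 * e ^ 2 * p₁ ^ 2 - e ^ 4) *
      (5 * p₁ ^ 4 - 2 * e ^ 2 * p₁ ^ 2 + e ^ 4) *
      (p₁ ^ 8 - 12 * e ^ 2 * p₁ ^ 6 - 26 * e ^ 4 * p₁ ^ 4 + 52 * e ^ 6 * p₁ ^ 2 + e ^ 8) * e ^ 0 =
      (V ^ 2 + e ^ 2 * W ^ 2) ^ 2 - 4 * p₁ * V * W * (V ^ 2 - e ^ 2 * W ^ 2) := by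
    simp only [hV, hW]; ring
  have hzero : -(3 * p₁ ^ 4 - 6 * e ^ 2 * p₁ ^ 2 - e ^ 4) *
      (5 * p₁ ^ 4 - 2 * e ^ 2 * p₁ ^ 2 + e ^ 4) *
      (p₁ ^ 8 - 12 * e ^ 2 * p₁ ^ 6 - 26 * e ^ 4 * p₁ ^ 4 + 52 * e ^ 6 * p₁ ^ 2 + e ^ 8) = 0 := by
    have := hfac
    rw [pow_zero, mul_one] at this
    rw [this]
    linear_combination -h2'
  -- the spurious factors do not vanish
  have hf5 : 5 * p₁ ^ 4 - 2 * e ^ 2 * p₁ ^ 2 + e ^ 4 ≠ 0 := (five_quartic_pos p₁ he).ne'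
  have hf3 : 3 * p₁ ^ 4 - 6 * e ^ 2 * p₁ ^ 2 - e ^ 4 ≠ 0 := by
    intro h3
    -- then `V = p₁ W`, so `p₂ W = p₁ W`
    have hVW : V = p₁ * W := by
      simp only [hV, hW]; linear_combination -h3
    have : (p₂ - p₁) * W = 0 := by linear_combination hY + hVW
    rcases mul_eq_zero.mp this with h | h
    · exact hne (by linarith)
    · exact hW0 h
  have := mul_eq_zero.mp hzero
  rcases this with h | h
  · rcases mul_eq_zero.mp h with h' | h'
    · exact absurd (neg_eq_zero.mp h') hf3
    · exact absurd h' hf5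
  · exact h

/-- **`℘(1/5)/ϖ₀²` is a root of the octic `x⁸ − 12x⁶ − 26x⁴ + 52x² + 1`** (homogeneous form).
[folklore] -/
theorem octic_weierstrassPRe_one_fifth :
    (ofUpperHalfPlane UpperHalfPlane.I).weierstrassPRe (1 / 5) ^ 8 -
        12 * ((Real.Gamma (1 / 4) ^ 2 / (2 * Real.sqrt (2 * π))) ^ 2) ^ 2 *
          (ofUpperHalfPlane UpperHalfPlane.I).weierstrassPRe (1 / 5) ^ 6 -
        26 * ((Real.Gamma (1 / 4) ^ 2 / (2 * Real.sqrt (2 * π))) ^ 2) ^ 4 *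
          (ofUpperHalfPlane UpperHalfPlane.I).weierstrassPRe (1 / 5) ^ 4 +
        52 * ((Real.Gamma (1 / 4) ^ 2 / (2 * Real.sqrt (2 * π))) ^ 2) ^ 6 *
          (ofUpperHalfPlane UpperHalfPlane.I).weierstrassPRe (1 / 5) ^ 2 +
        ((Real.Gamma (1 / 4) ^ 2 / (2 * Real.sqrt (2 * π))) ^ 2) ^ 8 = 0 := by
  have hord := weierstrassPRe_fifths_order
  have hϖ := varpi_pos
  set e := (Real.Gamma (1 / 4) ^ 2 / (2 * Real.sqrt (2 * π))) ^ 2 with he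
  have he0 : 0 < e := by positivity
  have hq : (1 + Real.sqrt 2) * e = (ofUpperHalfPlane UpperHalfPlane.I).weierstrassPRe (1 / 4) :=
    weierstrassPRe_quarter.symm
  have hs : (1 : ℝ) ≤ Real.sqrt 2 := Real.one_le_sqrt.mpr (by norm_num)
  refine octic_of_two_mul_relations he0 weierstrassPRe_two_fifths_mul weierstrassPRe_one_fifth_mul
    (by nlinarith [hord.2.1, hord.2.2]) ?_ ?_
  · nlinarith [hord.1, hord.2.1, hord.2.2]
  · nlinarith [hord.1, hord.2.1, hord.2.2]

/-- **`℘(2/5)/ϖ₀²` is a root of the octic `x⁸ − 12x⁶ − 26x⁴ + 52x² + 1`** (homogeneous form).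
[folklore] -/
theorem octic_weierstrassPRe_two_fifths :
    (ofUpperHalfPlane UpperHalfPlane.I).weierstrassPRe (2 / 5) ^ 8 -
        12 * ((Real.Gamma (1 / 4) ^ 2 / (2 * Real.sqrt (2 * π))) ^ 2) ^ 2 *
          (ofUpperHalfPlane UpperHalfPlane.I).weierstrassPRe (2 / 5) ^ 6 -
        26 * ((Real.Gamma (1 / 4) ^ 2 / (2 * Real.sqrt (2 * π))) ^ 2) ^ 4 *
          (ofUpperHalfPlane UpperHalfPlane.I).weierstrassPRe (2 / 5) ^ 4 +
        52 * ((Real.Gamma (1 / 4) ^ 2 / (2 * Real.sqrt (2 * π))) ^ 2) ^ 6 *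
          (ofUpperHalfPlane UpperHalfPlane.I).weierstrassPRe (2 / 5) ^ 2 +
        ((Real.Gamma (1 / 4) ^ 2 / (2 * Real.sqrt (2 * π))) ^ 2) ^ 8 = 0 := by
  have hord := weierstrassPRe_fifths_order
  have hϖ := varpi_pos
  set e := (Real.Gamma (1 / 4) ^ 2 / (2 * Real.sqrt (2 * π))) ^ 2 with he
  have he0 : 0 < e := by positivity
  refine octic_of_two_mul_relations he0 weierstrassPRe_one_fifth_mul weierstrassPRe_two_fifths_mul
    (by nlinarith [hord.2.1, hord.2.2]) ?_ ?_
  · nlinarith [hord.1, hord.2.1, hord.2.2]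
  · nlinarith [hord.1, hord.2.1, hord.2.2]

/-- **The symmetric functions of the real `5`-division values.** With `t₁ = ℘(1/5)²`,
`t₂ = ℘(2/5)²`, `E = ϖ₀⁴`: `t₁ + t₂ = (6 + 4√5)E` and `t₁ t₂ = (9 + 4√5)E²`. Indeed the octic in
`t = x²` is `((t − 3E)² − 4√5 E(t − E))((t − 3E)² + 4√5 E(t − E))`, the second factor is positive
for `t > E`, so `t₁, t₂ > E` are the two (distinct) roots of the first, a quadratic. [folklore] -/
theorem fifth_division_vieta :
    (ofUpperHalfPlane UpperHalfPlane.I).weierstrassPRe (1 / 5) ^ 2 +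
          (ofUpperHalfPlane UpperHalfPlane.I).weierstrassPRe (2 / 5) ^ 2 =
        (6 + 4 * Real.sqrt 5) * ((Real.Gamma (1 / 4) ^ 2 / (2 * Real.sqrt (2 * π))) ^ 2) ^ 2 ∧
      (ofUpperHalfPlane UpperHalfPlane.I).weierstrassPRe (1 / 5) ^ 2 *
          (ofUpperHalfPlane UpperHalfPlane.I).weierstrassPRe (2 / 5) ^ 2 =
        (9 + 4 * Real.sqrt 5) * ((Real.Gamma (1 / 4) ^ 2 / (2 * Real.sqrt (2 * π))) ^ 2) ^ 4 := by
  have hord := weierstrassPRe_fifths_order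
  have hϖ := varpi_pos
  set e := (Real.Gamma (1 / 4) ^ 2 / (2 * Real.sqrt (2 * π))) ^ 2 with he
  set p₁ := (ofUpperHalfPlane UpperHalfPlane.I).weierstrassPRe (1 / 5) with hp₁
  set p₂ := (ofUpperHalfPlane UpperHalfPlane.I).weierstrassPRe (2 / 5) with hp₂
  have he0 : 0 < e := by positivity
  set s := Real.sqrt 5 with hs
  have hs5 : s ^ 2 = 5 := Real.sq_sqrt (by norm_num)
  have hs0 : 2 < s := by
    rw [hs, show (2 : ℝ) = Real.sqrt 4 by
      rw [show (4 : ℝ) = 2 ^ 2 by norm_num, Real.sqrt_sq (by norm_num)]]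
    exact Real.sqrt_lt_sqrt (by norm_num) (by norm_num)
  have hq : (1 + Real.sqrt 2) * e = (ofUpperHalfPlane UpperHalfPlane.I).weierstrassPRe (1 / 4) :=
    weierstrassPRe_quarter.symm
  have hs2 : (1 : ℝ) ≤ Real.sqrt 2 := Real.one_le_sqrt.mpr (by norm_num)
  have h1e : e < p₁ := by nlinarith [hord.1, hord.2.1, hord.2.2]
  have h2e : e < p₂ := hord.1
  have h12 : p₂ < p₁ := by linarith [hord.2.1, hord.2.2]
  -- the octic in `t = p²` factors over `ℚ(√5)`
  have hfac : ∀ p : ℝ,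
      p ^ 8 - 12 * e ^ 2 * p ^ 6 - 26 * e ^ 4 * p ^ 4 + 52 * e ^ 6 * p ^ 2 + e ^ 8 =
      ((p ^ 2 - 3 * e ^ 2) ^ 2 - 4 * s * e ^ 2 * (p ^ 2 - e ^ 2)) *
        ((p ^ 2 - 3 * e ^ 2) ^ 2 + 4 * s * e ^ 2 * (p ^ 2 - e ^ 2)) := fun p ↦ by
    linear_combination (16 * e ^ 4 * (p ^ 2 - e ^ 2) ^ 2) * hs5
  have hpos : ∀ p : ℝ, e < p → 0 < (p ^ 2 - 3 * e ^ 2) ^ 2 + 4 * s * e ^ 2 * (p ^ 2 - e ^ 2) := by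
    intro p hp
    have h1 : 0 < p ^ 2 - e ^ 2 := by nlinarith
    have h2 : 0 < 4 * s * e ^ 2 * (p ^ 2 - e ^ 2) := by positivity
    nlinarith [sq_nonneg (p ^ 2 - 3 * e ^ 2)]
  have hroot : ∀ p : ℝ, e < p →
      p ^ 8 - 12 * e ^ 2 * p ^ 6 - 26 * e ^ 4 * p ^ 4 + 52 * e ^ 6 * p ^ 2 + e ^ 8 = 0 →
      (p ^ 2 - 3 * e ^ 2) ^ 2 - 4 * s * e ^ 2 * (p ^ 2 - e ^ 2) = 0 := by
    intro p hp h8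
    rw [hfac p] at h8
    rcases mul_eq_zero.mp h8 with h | h
    · exact h
    · exact absurd h (hpos p hp).ne'
  have r₁ := hroot p₁ h1e (by
    have := octic_weierstrassPRe_one_fifth
    simpa only [← he, ← hp₁] using this)
  have r₂ := hroot p₂ h2e (by
    have := octic_weierstrassPRe_two_fifths
    simpa only [← he, ← hp₂] using this)
  -- two distinct roots of the quadratic `(t − 3E)² − 4√5 E (t − E)` in `t`
  have hne : p₁ ^ 2 ≠ p₂ ^ 2 := by nlinarith
  have hsum : p₁ ^ 2 + p₂ ^ 2 = (6 + 4 * s) * e ^ 2 := by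
    have hdiff : (p₁ ^ 2 - p₂ ^ 2) * (p₁ ^ 2 + p₂ ^ 2 - (6 + 4 * s) * e ^ 2) = 0 := by
      linear_combination r₁ - r₂
    rcases mul_eq_zero.mp hdiff with h | h
    · exact absurd (sub_eq_zero.mp h) hne
    · linarith
  refine ⟨hsum, ?_⟩
  linear_combination (p₂ ^ 2) * hsum - r₂

end GaussianLattice

end Literature.NumberTheory.EllipticCurves

end
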